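import Summits.CriticalPhenomena.PercolationContinuityZ3.Theorems.FK.WeakMixingBelowCritical
import Summits.CriticalPhenomena.PercolationContinuityZ3.Theorems.FK.InfiniteVolumeInvariance
import HarnessLib

/-!
# EXPONENTIAL MIXING UNDER TRANSLATIONS BELOW `p_c(q)`: `|φ^b_{p,q}(E ∩ τ_v E′) − φ^b_{p,q}(E) φ^b_{p,q}(E′)| ≤ 4|F|e^{−c(‖v‖_∞ − 2k − 1)}`
# for local events `E, E′` in `Λ_k`, and Alexander's conditional form `|P(E | H) − P(E)| ≤ 4|F|e^{−c(n−k)}`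

Claimed R42 (8)(c) in the cell INBOX at 2026-08-28T10:00:12Z by fkp-10a gen 353 (NEW CLAIM #1 of the gen), under provision (ι) (no coordinator seated since gen 267's closing line l.8331: the lane lead absorbs the registry word, silence = consent; readers fk-ref / fkt-lead / fkp-18r / fkp-10b); lineage row FO-10a-g353 (self-suggested), package g353-weakmixing, label WM-F.
Helper file of the `fk-continuity` build cell (bschramm lane; `--supports stmt-CriticalPhenomena-4575`); builds on
p205010 (kernel theorem, internal audit signed; external expert review pending). No definitions, no named facts, no
sorries; standard axioms. UNCONDITIONAL. Reformulations of the weak mixing theorem of `WeakMixingBelowCritical.lean`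
over the same objects (the infinite-volume measures `φ^b_{p,q} = rcLimit d b p q`, `p < p_c(q)`):

* `exists_exp_condReal_sub_le_of_lt_rcCriticalProb` — **Alexander's (1.1) verbatim (p. 444: `sup |P(A | B) − P(A)|`)**:
  `|P(E ∩ H)/P(H) − P(E)| ≤ 4·|F|·e^{−c(n−k)}` for every FK-Gibbs `P`, `P(H) > 0`, `E` determined by `F ⊆ E_{Λ_k}`, `H`
  determined by finitely many pairs off `E_{Λ_n}`, `k < n`;
* `exists_exp_translate_mixing_of_lt_rcCriticalProb` — **the mixing property (Duminil-Copin 2019, eq. (Mixing):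
  `φ[A ∩ τ_x B] → φ[A]φ[B]`) WITH AN EXPONENTIAL RATE below `p_c(q)`**: for `E, E′` determined by `F, F′ ⊆ E_{Λ_k}` and
  every `v ∈ ℤ^d` with `‖v‖_∞ > 2k + 1`,
  `|φ^b_{p,q}(E ∩ {ω | ω + v ∈ E′}) − φ^b_{p,q}(E)·φ^b_{p,q}(E′)| ≤ 4·|F|·e^{−c(‖v‖_∞ − 2k − 1)}` (translation invariance,
  Grimmett Thm. (4.19)(b): the translate of `E′` is a local event off `E_{Λ_{‖v‖−k−1}}` of the same probability).

## References

* K. S. Alexander, *On weak mixing in lattice models*, PTRF 110 (1998) 441–471, (1.1) and p. 444. [Alexander1998]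
* H. Duminil-Copin, *Lectures on the Ising and Potts models on the hypercubic lattice* (2019), §1.3 eq. (Mixing) and
  Exercise 14. [DuminilCopin2019]
* G. Grimmett, *The Random-Cluster Model*, Springer 2006, Thm. (4.19)(b), Cor. (4.23) (mixing ⇒ ergodicity). [Grimmett2006]
-/

noncomputable section

namespace Summit.CriticalPhenomena.PercolationContinuityZ3.Theorems.FK

namespace BoundaryInfluence

open MeasureTheory Finset
open Literature.Probability.Percolation Literature.Probability.LatticeModels Literature.Barriers.CriticalPhenomena
open Literature.Probability.Percolation.OneArmOSSS Literature.Probability.Percolation.DCT16 MonotonicOSSS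

variable {d : ℕ} {p q : ℝ}

/-- **Alexander's weak mixing property (1.1) in its conditional form**: for `d ≥ 2`, `q ≥ 1`, `0 ≤ p < p_c(q)` there is
`c > 0` with `|P(E | H) − P(E)| ≤ 4·|F|·e^{−c(n−k)}` for every FK-Gibbs `P`, every `H` of positive probability
determined by finitely many pairs off `E_{Λ_n}`, and every `E` determined by `F ⊆ E_{Λ_k}`, `k < n`.
[cite: Alexander1998, (1.1) and p. 444; DuminilCopinRaoufiTassion2019, Thm. 1.2 (1)] -/
theorem exists_exp_condReal_sub_le_of_lt_rcCriticalProb (hd : 2 ≤ d) (hq : 1 ≤ q) (hp0 : 0 ≤ p)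
    (hpc : p < rcCriticalProb d q) :
    ∃ c : ℝ, 0 < c ∧ ∀ ⦃P : Measure (BondConfig (Site d))⦄, FKGibbs d p q P → ∀ ⦃k n : ℕ⦄, k < n →
      ∀ ⦃F : Finset (Sym2 (Site d))⦄, F ⊆ edgesIn (zdGraph d) (box d k) →
      ∀ ⦃E : Set (BondConfig (Site d))⦄, DeterminedBy E ↑F →
      ∀ ⦃H : Set (BondConfig (Site d))⦄ (T : Finset (Sym2 (Site d))),
        Disjoint (↑T : Set (Sym2 (Site d))) ↑(edgesIn (zdGraph d) (box d n)) → DeterminedBy H ↑T → 0 < P.real H →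
          |P.real (E ∩ H) / P.real H - P.real E| ≤ 4 * #F * Real.exp (-(c * ((n : ℝ) - k))) := by
  obtain ⟨c, hc, h⟩ := exists_exp_weakMixing_local_of_lt_rcCriticalProb hd hq hp0 hpc
  refine ⟨c, hc, fun P hP k n hkn F hF E hE H T hT hH hH0 => ?_⟩
  have key := h hP hkn hF hE T hT hH
  have heq : P.real (E ∩ H) / P.real H - P.real E = (P.real (E ∩ H) - P.real E * P.real H) / P.real H := by
    field_simp
  rw [heq, abs_div, abs_of_pos hH0, div_le_iff₀ hH0]
  calc |P.real (E ∩ H) - P.real E * P.real H| ≤ 4 * P.real H * #F * Real.exp (-(c * ((n : ℝ) - k))) := key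
    _ = 4 * #F * Real.exp (-(c * ((n : ℝ) - k))) * P.real H := by ring

/-- Shifting a pair set out of a box: if every pair of `T` has its points in `Λ_k` and `‖v‖_∞ > k + n`, then `T − v`
misses `E_{Λ_n}`. [folklore] -/
theorem disjoint_map_shift_edgesIn_box {k n : ℕ} {T : Finset (Sym2 (Site d))} (hT : T ⊆ edgesIn (zdGraph d) (box d k))
    {v : Site d} (hv : k + n < siteRad v) :
    Disjoint (↑(T.map (sym2Equiv (Site.shift (-v))).toEmbedding) : Set (Sym2 (Site d))) ↑(edgesIn (zdGraph d) (box d n)) := by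
  rw [Finset.disjoint_coe, Finset.disjoint_left]
  intro e he hen
  rw [Finset.mem_map] at he
  obtain ⟨f, hf, rfl⟩ := he
  have hfk := mem_edgesIn_iff.1 (hT hf)
  have hen' := mem_edgesIn_iff.1 hen
  induction f using Sym2.ind with
  | h x y =>
    have hx : siteRad x ≤ k := mem_box_iff_siteRad_le.1 (hfk.2 x (Sym2.mem_mk_left x y))
    have hxv : siteRad (x + -v) ≤ n := by
      refine mem_box_iff_siteRad_le.1 (hen'.2 (x + -v) ?_)
      rw [Equiv.toEmbedding_apply, sym2Equiv_apply, Sym2.map_mk]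
      exact Sym2.mem_mk_left _ _
    have htri : siteRad v ≤ siteRad x + siteRad (x + -v) := by
      have h1 := siteRad_add_le x (-(x + -v))
      rw [show x + -(x + -v) = v by abel] at h1
      rwa [siteRad_neg] at h1
    omega

/-- **EXPONENTIAL MIXING UNDER TRANSLATIONS BELOW `p_c(q)`** (`d ≥ 2`, `q ≥ 1`, `0 ≤ p < p_c(q)`, both `b`): there is
`c > 0` such that for every `k`, all events `E, E′` determined by `F, F′ ⊆ E_{Λ_k}` and every `v ∈ ℤ^d` with
`‖v‖_∞ > 2k + 1`: `|φ^b_{p,q}(E ∩ {ω | ω + v ∈ E′}) − φ^b_{p,q}(E)·φ^b_{p,q}(E′)| ≤ 4·|F|·e^{−c(‖v‖_∞ − 2k − 1)}`.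
[cite: DuminilCopin2019, §1.3 eq. (Mixing); Grimmett2006, Thm. (4.19)(b) and Cor. (4.23); Alexander1998, (1.1)] -/
theorem exists_exp_translate_mixing_of_lt_rcCriticalProb (hd : 2 ≤ d) (hq : 1 ≤ q) (hp0 : 0 ≤ p)
    (hpc : p < rcCriticalProb d q) :
    ∃ c : ℝ, 0 < c ∧ ∀ (b : Bool) ⦃k : ℕ⦄ ⦃F F' : Finset (Sym2 (Site d))⦄,
      F ⊆ edgesIn (zdGraph d) (box d k) → F' ⊆ edgesIn (zdGraph d) (box d k) →
      ∀ ⦃E E' : Set (BondConfig (Site d))⦄, DeterminedBy E ↑F → DeterminedBy E' ↑F' →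
      ∀ ⦃v : Site d⦄, 2 * k + 1 < siteRad v →
        |(rcLimit d b p q).real (E ∩ BondConfig.relabel (sym2Equiv (Site.shift v)) ⁻¹' E') -
            (rcLimit d b p q).real E * (rcLimit d b p q).real E'| ≤
          4 * #F * Real.exp (-(c * ((siteRad v : ℝ) - 2 * k - 1))) := by
  have hp : p ∈ Set.Icc (0 : ℝ) 1 := ⟨hp0, (hpc.trans (rcCriticalProb_lt_one hd hq)).le⟩
  obtain ⟨c, hc, h⟩ := exists_exp_weakMixing_local_of_lt_rcCriticalProb hd hq hp0 hpc
  refine ⟨c, hc, fun b k F F' hF hF' E E' hE hE' v hv => ?_⟩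
  have hBL : IsBoxLimit d b p q (rcLimit d b p q) := isBoxLimit_rcLimit b hp hq
  haveI := hBL.isProbabilityMeasure
  have hG : FKGibbs d p q (rcLimit d b p q) := hBL.fkGibbs hp hq
  -- the translate of `E'` is determined off `E_{Λ_n}`, `n = ‖v‖ − k − 1`, and has the same probability
  set n : ℕ := siteRad v - k - 1 with hn
  have hkn : k < n := by omega
  have hT := disjoint_map_shift_edgesIn_box hF' (v := v) (n := n) (by omega)
  have hH := determinedBy_preimage_relabel_shift hE' v
  have hE'm : MeasurableSet E' := hE'.measurableSet_of_finset
  have hshift : (rcLimit d b p q).real (BondConfig.relabel (sym2Equiv (Site.shift v)) ⁻¹' E') = (rcLimit d b p q).real E' := by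
    rw [measureReal_def, hBL.measure_preimage_relabel_shift hp hq v E', measureReal_def]
  have key := h hG hkn hF hE _ hT hH
  have hcast : ((n : ℝ) - k) = (siteRad v : ℝ) - 2 * k - 1 := by
    rw [hn, Nat.cast_sub (by omega), Nat.cast_sub (by omega), Nat.cast_one]; ring
  rw [hshift, hcast] at key
  refine key.trans ?_
  have h1 : (rcLimit d b p q).real E' ≤ 1 := measureReal_le_one
  have hF0 : (0 : ℝ) ≤ #F := Nat.cast_nonneg _
  have hexp : 0 ≤ Real.exp (-(c * ((siteRad v : ℝ) - 2 * k - 1))) := (Real.exp_pos _).le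
  calc 4 * (rcLimit d b p q).real E' * #F * Real.exp (-(c * ((siteRad v : ℝ) - 2 * k - 1)))
      ≤ 4 * 1 * #F * Real.exp (-(c * ((siteRad v : ℝ) - 2 * k - 1))) := by gcongr
    _ = 4 * #F * Real.exp (-(c * ((siteRad v : ℝ) - 2 * k - 1))) := by ring

end BoundaryInfluence

end Summit.CriticalPhenomena.PercolationContinuityZ3.Theorems.FK

end
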